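import Summits.HodgeConjecture.HodgeConjecture.Theorems.SixfoldTableXOffResidue
import Literature.AlgebraicGeometry.VanGeemen1994.WeilTypeGeneralMemberPortrait
import Literature.AlgebraicGeometry.Milne1999.SimpleIsogenyFactorsUniqueness
import Literature.AlgebraicGeometry.HodgeTheory.HodgeGroupProductCMFactorLowDimHolds
import Literature.AlgebraicGeometry.ComplexMultiplication.CMAbelianVarietyRealisedHolds
import Summits.HodgeConjecture.HodgeConjecture.Theorems.Ring2AtlasCMSixfoldsDegenerateNonVacuity
import Summits.HodgeConjecture.HodgeConjecture.Theorems.Ring2HypothesesAtlasSixfolds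
import HarnessLib

/-!
# TABLE X (dimension 6) — the classes of the cell's theorems are WELL-POSED: isogeny-closed, inhabited
# off and on the residue, and the Weil sector lies off the residue (cell `pub-hodgeav-hg6`, req-37 (A) Q2b; eng-4 g2)

HONEST FRAMING. HC, `HC_AV` (stmt-1333), `HC_CM` (`Theses.RankFourFaces.CMAbelianHodge`, stmt-3052) and the rung H2
(`Theses.SevenfoldWeilCensus.WeilSixfolds` / `WeilTypeLadder.NonsplitSixfolds`) are NOT proved and do not occur in this
module except, in §3, as HYPOTHESES BY NAME handed on to the landed off-residue theorem. The census nodes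
`TableX.SixfoldCodimTwoCensus` / `TableX.SixfoldCodimThreeCensus` are OURS (`@[conjecture]`, never asserted). KERNEL
ONLY: theorems over existing declarations; no definition, no `sorry`, no new named fact.

WHY THIS MODULE. The landed cover (`SixfoldTableXCover`: `hcAtDim_six_of_tableX_residues`, `…_cmSplit`) and the
charter's per-variety theorem (`SixfoldTableXOffResidue`: `hcOnClass_six_offResidue_of_tableX_residues`) are class
targets `HCOnClass 𝒦` and hypotheses quantified over classes of complex abelian sixfolds cut out by the RESIDUE CLASS
`𝒞 A := IsOfCMType A ∨ ProdCMCell IsQuarticFieldTypeIVFourfold (dim = 2) A` (CM ∪ the K3-partner cell). A class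
target over an EMPTY class is true for the wrong reason, and a class that is not closed under isogeny would make the
census nodes false for a trivial reason (an isogenous twin of a residue member would sit off the residue with the
residue's exceptional classes). This file records, sorry-free, the audit the D-0009 reviewers and the cell's 09-04
decision record ask for (ring 2's standard, cf. `Ring2AtlasCMSixfoldsNonVacuity`):

* §1 ISOGENY-CLOSURE: `𝒞` is closed under isogeny (`residueClass_iff_of_isIsogenous`), hence so are the off-residue
  class `dim A = 6 ∧ ¬ 𝒞 A` of the per-variety theorem / of the census nodes' domain and the on-residue class.
* §2 NO SIMPLE VARIETY LIES IN THE K3-PARTNER CELL (`not_prodCMCell_quarticTypeIV_of_isSimple`: a member is isogenous to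
  `Y × Z` with `dim Y = 4`, `dim Z = 2`, and a product of positive-dimensional abelian varieties is not simple), so a
  SIMPLE sixfold that is not of CM type is OFF the residue (`not_residueClass_of_isSimple_of_not_isOfCMType`).
* §3 THE WEIL SECTOR IS OFF THE RESIDUE: van Geemen's general abelian variety of Weil type (`Hg = SU_H`,
  `HasHodgeGroupSU`, LNM 1594 Thm. 6.11/6.12; the tree's portrait `weilType_generalMember_portrait`: simple, not of CM
  type) is off `𝒞` in every dimension `2n ≥ 4` (`not_residueClass_of_hasHodgeGroupSU`); at `n = 3` these are the R-W6
  carriers of TABLE X row 9, so the residue `WeilTypeLadder.NonsplitSixfolds` is exercised INSIDE the class of the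
  per-variety theorem, which indeed yields HC for them (`hodgeConjectureFor_generalWeilSixfold_of_tableX_residues`).
* §4 UNCONDITIONAL INHABITANTS: the off-residue class of sixfolds is inhabited — `E × E⁵` for the tree's elliptic curve
  without complex multiplication (`NonCMCurve.exists_ellipticCurve_not_isOfCMType`; not CM by
  `TypeIVProduct.not_isOfCMType_prod_of_left`; not in the K3-partner cell because every simple isogeny factor of `E⁶` is
  isogenous to `E`, of dimension `1 ≠ 4`, Milne 1986 §12 via the tree's `IsSimpleIsogenyFactor` calculus) —
  `exists_dim_six_offResidue`; and so are the on-residue class and the NARROWED CM BINDER's class of the cover v3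
  (`dim A = 6 ∧ IsOfCMType A ∧ ¬ A.IsSimple`: `C₅ × C₁` for CM varieties of dimensions 5 and 1, which exist
  unconditionally by the tree's realisation record `CMAbelianVarietyRealised_holds`) — `exists_dim_six_cm_not_isSimple`,
  `exists_dim_six_residueClass`. Consequently none of `hcOnClass_six_offResidue_of_tableX_residues`,
  `hcOnClass_residueClass_six`, `hCMns` is a statement about the empty class (`not_hcOnClass_offResidueSix_vacuous` etc.
  spell this out as `¬ ∀ A, ¬ 𝒦 A`).

Nothing here is a corollary of `HC_CM`; `HC_CM` does not occur. The simple CM sixfolds (rows 14–15) are inhabited by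
COR-CM's `CorCM.exists_simple_cm_sixfold` / ring 2's `Ring2AtlasCMCellsUnconditional` and are not re-done here.
-/

set_option linter.dupNamespace false

noncomputable section

open CategoryTheory
open Literature.AlgebraicGeometry Literature.AlgebraicGeometry.Motives
open Literature.AlgebraicGeometry.Motives.AbelianVariety (IsIsogenous IsSimple)
open Literature.AlgebraicGeometry.HodgeTheory
open Literature.AlgebraicGeometry.Milne1999
open Literature.AlgebraicGeometry.VanGeemen1994 (HasHodgeGroupSU hK isSimple_of_hasHodgeGroupSU
  not_isOfCMType_of_hasHodgeGroupSU)
open Literature.AlgebraicTopology.SingularHomology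
open Literature.Barriers.HodgeConjecture
open Summit.HodgeConjecture.HodgeConjecture.Ring2.ClassTargets
open Summit.HodgeConjecture.HodgeConjecture.Ring2.Motiv (ProdCMCell prodCMCell_of_isIsogenous)
open Summit.HodgeConjecture.HodgeConjecture.Ring2.Atlas (IsQuarticFieldTypeIVFourfold
  HodgeQuarticTypeIVFourfoldTimesCMSurface)

namespace Summit.HodgeConjecture.HodgeConjecture.TableX

/-! ## §1 The residue class is isogeny-closed -/

/-- **The residue class `𝒞 = CM ∪ K3P` of TABLE X is closed under isogeny**: being of CM type is an isogeny
invariant (`End⁰` is), and the K3-partner cell is isogeny-closed by definition (`ProdCMCell`: isogenous to some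
`Y × Z`). [cite: Milne1999, §2 p. 54] [cite: MoonenZarhin1999LowDim, §3 (3.1) and §5 Case 2] -/
theorem residueClass_of_isIsogenous {A B : AbelianVariety ℂ} (hAB : IsIsogenous A B)
    (hB : IsOfCMType B ∨ ProdCMCell IsQuarticFieldTypeIVFourfold (fun Z ↦ Z.dim = 2) B) :
    IsOfCMType A ∨ ProdCMCell IsQuarticFieldTypeIVFourfold (fun Z ↦ Z.dim = 2) A :=
  hB.imp (isOfCMType_iff_of_isIsogenous hAB).mpr (prodCMCell_of_isIsogenous hAB)

/-- Isogenous abelian varieties lie in the residue class together. [cite: Milne1999, §2 p. 54]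
[cite: MoonenZarhin1999LowDim, §3 (3.1)] -/
theorem residueClass_iff_of_isIsogenous {A B : AbelianVariety ℂ} (hAB : IsIsogenous A B) :
    (IsOfCMType A ∨ ProdCMCell IsQuarticFieldTypeIVFourfold (fun Z ↦ Z.dim = 2) A) ↔
      (IsOfCMType B ∨ ProdCMCell IsQuarticFieldTypeIVFourfold (fun Z ↦ Z.dim = 2) B) :=
  ⟨residueClass_of_isIsogenous hAB.symm', residueClass_of_isIsogenous hAB⟩

/-- **The OFF-residue class of sixfolds** (the class of the per-variety theorem
`hcOnClass_six_offResidue_of_tableX_residues`, and the domain of the census nodes) **is isogeny-closed**.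
[cite: Milne1999, §2 p. 54] [cite: MumfordAV1970, §19 Thm. 3 (p. 176)] -/
theorem offResidueSix_iff_of_isIsogenous {A B : AbelianVariety ℂ} (hAB : IsIsogenous A B) :
    (A.dim = 6 ∧ ¬ (IsOfCMType A ∨ ProdCMCell IsQuarticFieldTypeIVFourfold (fun Z ↦ Z.dim = 2) A)) ↔
      (B.dim = 6 ∧ ¬ (IsOfCMType B ∨ ProdCMCell IsQuarticFieldTypeIVFourfold (fun Z ↦ Z.dim = 2) B)) := by
  rw [hAB.dim_eq, residueClass_iff_of_isIsogenous hAB]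

/-- **The ON-residue class of sixfolds** (what the cover's §2 binders serve) **is isogeny-closed**.
[cite: Milne1999, §2 p. 54] [cite: MumfordAV1970, §19 Thm. 3 (p. 176)] -/
theorem residueClassSix_iff_of_isIsogenous {A B : AbelianVariety ℂ} (hAB : IsIsogenous A B) :
    ((IsOfCMType A ∨ ProdCMCell IsQuarticFieldTypeIVFourfold (fun Z ↦ Z.dim = 2) A) ∧ A.dim = 6) ↔
      ((IsOfCMType B ∨ ProdCMCell IsQuarticFieldTypeIVFourfold (fun Z ↦ Z.dim = 2) B) ∧ B.dim = 6) := by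
  rw [hAB.dim_eq, residueClass_iff_of_isIsogenous hAB]

/-! ## §2 Simple varieties: never in the K3-partner cell; off the residue unless of CM type -/

/-- **No simple abelian variety lies in the K3-partner cell**: a member is isogenous to `Y × Z` with `Y` a simple
type-IV fourfold (`dim Y = 4`) and `Z` a CM surface (`dim Z = 2`), and a product of two abelian varieties of
positive dimension is not simple (Mumford §19 Cor. 1–2), while simplicity is an isogeny invariant.
[cite: MumfordAV1970, §19 Cor. 1–2 of Thm. 1 (pp. 173–174)] [cite: MoonenZarhin1999LowDim, §5 Case 2] -/
theorem not_prodCMCell_quarticTypeIV_of_isSimple {A : AbelianVariety ℂ} (hA : A.IsSimple) :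
    ¬ ProdCMCell IsQuarticFieldTypeIVFourfold (fun Z ↦ Z.dim = 2) A := by
  rintro ⟨Y, Z, hiso, hY, -, hZ2⟩
  have hY4 : Y.dim = 4 := hY.1
  exact AbelianVariety.not_isSimple_prod (A := Y) (B := Z) (by omega) (by omega) (hA.of_isIsogenous hiso)

/-- **A simple abelian variety that is not of CM type is OFF the residue class of TABLE X.**
[cite: MumfordAV1970, §19 Cor. 1–2 of Thm. 1 (pp. 173–174)] [cite: Milne1999, §2 p. 54] -/
theorem not_residueClass_of_isSimple_of_not_isOfCMType {A : AbelianVariety ℂ} (hA : A.IsSimple)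
    (hcm : ¬ IsOfCMType A) :
    ¬ (IsOfCMType A ∨ ProdCMCell IsQuarticFieldTypeIVFourfold (fun Z ↦ Z.dim = 2) A) :=
  fun h ↦ h.elim hcm (not_prodCMCell_quarticTypeIV_of_isSimple hA)

/-! ## §3 The Weil sector lies off the residue: van Geemen's general member -/

/-- **The general abelian variety of Weil type is OFF the residue class** (every dimension `2n ≥ 4`, every
discriminant parameter `d ≥ 1`): with `Hg(A) = SU_H` (`HasHodgeGroupSU`, van Geemen LNM 1594 Thm. 6.11) the variety
is simple and not of CM type (tree: `isSimple_of_hasHodgeGroupSU`, `not_isOfCMType_of_hasHodgeGroupSU`), so §2 applies.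
[cite: vanGeemen1994HodgeAV, Thm. 4.11 and 6.9–6.12] [cite: MoonenZarhin1999LowDim, §1] -/
theorem not_residueClass_of_hasHodgeGroupSU (A : AbelianVariety ℂ) (φ : A ⟶ A) (n d : ℕ)
    (e : ProjectiveEmbedding A.X) (a : complexBetti (projectiveSpace e.n ℂ) 2)
    (hn : 2 ≤ n) (hd : 0 < d) (hA : A.dim = 2 * n) (hφ : φ ≫ φ = -(d • 𝟙 A))
    (ha : IsRationalClass a) (ha0 : a ≠ 0) (hSU : HasHodgeGroupSU A φ n d (hK d φ e a)) :
    ¬ (IsOfCMType A ∨ ProdCMCell IsQuarticFieldTypeIVFourfold (fun Z ↦ Z.dim = 2) A) :=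
  not_residueClass_of_isSimple_of_not_isOfCMType
    (isSimple_of_hasHodgeGroupSU A φ n d e a hn hd hA hφ ha ha0 hSU)
    (not_isOfCMType_of_hasHodgeGroupSU A φ n d e a hn hd hA hφ ha ha0 hSU)

/-- **The general Weil-type SIXFOLD (TABLE X row 9, the R-W6 carrier) belongs to the class of the per-variety
theorem**: `dim A = 6` and `A` is off the residue. So the residue hypothesis `WeilTypeLadder.NonsplitSixfolds` of
`hcOnClass_six_offResidue_of_tableX_residues` is consumed on members of that very class, not idly.
[cite: vanGeemen1994HodgeAV, Thm. 6.11–6.12] [cite: MoonenZarhin1999LowDim, §1 and Thm. 0.2] -/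
theorem mem_offResidueSix_of_hasHodgeGroupSU (A : AbelianVariety ℂ) (φ : A ⟶ A) (d : ℕ)
    (e : ProjectiveEmbedding A.X) (a : complexBetti (projectiveSpace e.n ℂ) 2)
    (hd : 0 < d) (hA : A.dim = 2 * 3) (hφ : φ ≫ φ = -(d • 𝟙 A))
    (ha : IsRationalClass a) (ha0 : a ≠ 0) (hSU : HasHodgeGroupSU A φ 3 d (hK d φ e a)) :
    A.dim = 6 ∧ ¬ (IsOfCMType A ∨ ProdCMCell IsQuarticFieldTypeIVFourfold (fun Z ↦ Z.dim = 2) A) :=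
  ⟨hA, not_residueClass_of_hasHodgeGroupSU A φ 3 d e a (by norm_num) hd hA hφ ha ha0 hSU⟩

/-- **HC for the general Weil-type sixfold from the hypotheses of the per-variety theorem** (two Markman facts,
R-W6 = `NonsplitSixfolds`, the two census nodes): an instance of `hcOnClass_six_offResidue_of_tableX_residues` on a
member supplied by §3 — the binders `HC_CM`, `hS`, R-K3P of the cover are not involved for the Weil sector.
None of the hypotheses is asserted. [cite: vanGeemen1994HodgeAV, Thm. 6.12] [cite: MoonenZarhin1999LowDim, Thm. 0.2, §5]
[cite: Markman2025SecantWeil, Thm. 1.5.1 (preprint, unrefereed)] [claim: Markman2025SurveySecant, status: under-review] -/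
theorem hodgeConjectureFor_generalWeilSixfold_of_tableX_residues
    (hMark₄ : Markman2025_weilClasses_algebraic_abelianFourfold)
    (hMark₆ : Markman2025_weilClasses_algebraic_hyperbolicSixfold)
    (hRW6 : WeilTypeLadder.NonsplitSixfolds)
    (hX2 : SixfoldCodimTwoCensus) (hX1 : SixfoldCodimThreeCensus)
    (A : AbelianVariety ℂ) (φ : A ⟶ A) (d : ℕ)
    (e : ProjectiveEmbedding A.X) (a : complexBetti (projectiveSpace e.n ℂ) 2)
    (hd : 0 < d) (hA : A.dim = 2 * 3) (hφ : φ ≫ φ = -(d • 𝟙 A))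
    (ha : IsRationalClass a) (ha0 : a ≠ 0) (hSU : HasHodgeGroupSU A φ 3 d (hK d φ e a)) :
    HodgeConjectureFor A.dim A.X :=
  hcOnClass_six_offResidue_of_tableX_residues hMark₄ hMark₆ hRW6 hX2 hX1 A
    (mem_offResidueSix_of_hasHodgeGroupSU A φ d e a hd hA hφ ha ha0 hSU)

/-! ## §4 Unconditional inhabitants: the classes of the cell's theorems are not empty -/

/-- `dim (E × E⁵) = 6` for an elliptic curve `E` (`E⁵ = E.powSucc 4`). [cite: MumfordAV1970, §4 (products)] -/
theorem dim_prod_powSucc_four {E : AbelianVariety ℂ} (hE1 : E.dim = 1) : (E.prod (E.powSucc 4)).dim = 6 := by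
  simp only [AbelianVariety.dim_prod, AbelianVariety.powSucc_succ, AbelianVariety.powSucc_zero, hE1]

/-- **Every simple isogeny factor of `E × E⁵` is isogenous to `E`** (Milne 1986 §12: the simple isogeny factors
of a product are those of the factors, of a power those of the base, of a simple variety itself up to isogeny).
[cite: Milne1986AbelianVarieties, §12 p. 122] [cite: MumfordAV1970, §19 Cor. 1–2 (pp. 173–174)] -/
theorem isIsogenous_of_isSimpleIsogenyFactor_prod_powSucc_four {E Y : AbelianVariety ℂ} (hE1 : E.dim = 1)
    (hY : IsSimpleIsogenyFactor Y (E.prod (E.powSucc 4))) : IsIsogenous Y E := by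
  have hE : IsSimpleIsogenyFactor Y E := by
    rcases isSimpleIsogenyFactor_prod_iff.mp hY with h | h
    · exact h
    · exact (isSimpleIsogenyFactor_powSucc_iff 4).mp h
  exact (isSimpleIsogenyFactor_iff_isIsogenous_of_isSimple
    (AbelianVariety.isSimple_of_dim_le_one hE1.le) (by omega)).mp hE

/-- **`E × E⁵` is not in the K3-partner cell** for any elliptic curve `E`: a simple type-IV fourfold `Y` with
`E × E⁵ ∼ Y × Z` would be a simple isogeny factor of `E × E⁵`, hence isogenous to `E` — but `dim Y = 4 ≠ 1 = dim E`
and isogenous varieties have the same dimension. [cite: Milne1986AbelianVarieties, §12 p. 122]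
[cite: MumfordAV1970, §19 Cor. 1–2 (pp. 173–174)] -/
theorem not_prodCMCell_quarticTypeIV_prod_powSucc_four {E : AbelianVariety ℂ} (hE1 : E.dim = 1) :
    ¬ ProdCMCell IsQuarticFieldTypeIVFourfold (fun Z ↦ Z.dim = 2) (E.prod (E.powSucc 4)) := by
  rintro ⟨Y, Z, hiso, hY, -, -⟩
  obtain ⟨hY4, hYs, -⟩ := hY
  have hfac : IsSimpleIsogenyFactor Y (E.prod (E.powSucc 4)) :=
    (isSimpleIsogenyFactor_congr_right hiso).mpr ((isSimpleIsogenyFactor_self hYs (by omega)).prod_left)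
  have h := (isIsogenous_of_isSimpleIsogenyFactor_prod_powSucc_four hE1 hfac).dim_eq
  omega

/-- **`E × E⁵` is OFF the residue class for an elliptic curve `E` WITHOUT complex multiplication**: not of CM type
(`E ↪ E × E⁵` is a simple abelian subvariety, and subvarieties of CM varieties are CM — the tree's
`TypeIVProduct.not_isOfCMType_prod_of_left`) and not in the K3-partner cell (previous lemma).
[cite: Shimura1998, §5.1 Propositions 3, 4, 6] [cite: Milne1986AbelianVarieties, §12 p. 122] -/
theorem not_residueClass_prod_powSucc_four_of_not_isOfCMType {E : AbelianVariety ℂ} (hE1 : E.dim = 1)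
    (hEcm : ¬ IsOfCMType E) :
    ¬ (IsOfCMType (E.prod (E.powSucc 4)) ∨
        ProdCMCell IsQuarticFieldTypeIVFourfold (fun Z ↦ Z.dim = 2) (E.prod (E.powSucc 4))) :=
  fun h ↦ h.elim (TypeIVProduct.not_isOfCMType_prod_of_left hE1 hEcm)
    (not_prodCMCell_quarticTypeIV_prod_powSucc_four hE1)

/-- **THE OFF-RESIDUE CLASS OF SIXFOLDS IS INHABITED, UNCONDITIONALLY**: there is a complex abelian variety of
dimension `6` that is neither of CM type nor in the K3-partner cell — `E × E⁵` for the tree's elliptic curve without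
complex multiplication (`NonCMCurve.exists_ellipticCurve_not_isOfCMType`, from Riemann's theorem applied to the
period `√2 + i`). So the per-variety theorem `hcOnClass_six_offResidue_of_tableX_residues` and the census nodes
`SixfoldCodimTwoCensus` / `SixfoldCodimThreeCensus` quantify over a NON-EMPTY class.
[cite: MoonenZarhin1999LowDim, §2 (g = 1), Type I(1)] [cite: Milne1986AbelianVarieties, §12 p. 122]
[cite: Shimura1998, §5.1 Propositions 3, 4, 6] -/
theorem exists_dim_six_offResidue :
    ∃ A : AbelianVariety ℂ, A.dim = 6 ∧
      ¬ (IsOfCMType A ∨ ProdCMCell IsQuarticFieldTypeIVFourfold (fun Z ↦ Z.dim = 2) A) := by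
  obtain ⟨E, hE1, -, -, hEcm⟩ := NonCMCurve.exists_ellipticCurve_not_isOfCMType
  exact ⟨E.prod (E.powSucc 4), dim_prod_powSucc_four hE1,
    not_residueClass_prod_powSucc_four_of_not_isOfCMType hE1 hEcm⟩

/-- The off-residue class target of `SixfoldTableXOffResidue` is NOT a statement about the empty class.
[cite: MoonenZarhin1999LowDim, §2 (g = 1), Type I(1)] -/
theorem not_offResidueSix_vacuous :
    ¬ ∀ A : AbelianVariety ℂ, ¬ (A.dim = 6 ∧
      ¬ (IsOfCMType A ∨ ProdCMCell IsQuarticFieldTypeIVFourfold (fun Z ↦ Z.dim = 2) A)) := by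
  obtain ⟨A, h6, hA⟩ := exists_dim_six_offResidue
  exact fun h ↦ h A ⟨h6, hA⟩

/-- **THE NARROWED CM BINDER'S CLASS IS INHABITED, UNCONDITIONALLY**: there is a complex abelian SIXFOLD of CM type
that is NOT simple — `C₅ × C₁` for abelian varieties of CM type of dimensions `5` and `1`, which exist by the tree's
realisation record (`ComplexMultiplication.exists_isOfCMType_dim_eq_succ`, Shimura 1998 §6.2 Thm. 3, a theorem of the
tree via `CMAbelianVarietyRealised_holds`); products of CM varieties are CM (Milne 1999 p. 54) and a product of
positive-dimensional varieties is not simple (Mumford §19). So the displayed binder `hCMns : HCOnClass (dim = 6 ∧ CM ∧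
¬ simple)` of `hcAtDim_six_of_tableX_cmSplit` (TABLE X row 29) is a statement about a NON-EMPTY class — it is a
genuine residue, not a vacuous hypothesis. Nothing about `HC_CM` is proved. [cite: Shimura1998, §6.2 Theorem 3 (pp. 41–42)]
[cite: Milne1999, §2 p. 54] [cite: MumfordAV1970, §19 Cor. 1–2 (pp. 173–174)] -/
theorem exists_dim_six_cm_not_isSimple :
    ∃ A : AbelianVariety ℂ, A.dim = 6 ∧ IsOfCMType A ∧ ¬ A.IsSimple := by
  obtain ⟨C₅, -, h₅, hd₅⟩ := ComplexMultiplication.exists_isOfCMType_dim_eq_succ 4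
  obtain ⟨C₁, -, h₁, hd₁⟩ := ComplexMultiplication.exists_isOfCMType_dim_eq_succ 0
  refine ⟨C₅.prod C₁, ?_, h₅.prod h₁, AbelianVariety.not_isSimple_prod (by omega) (by omega)⟩
  rw [AbelianVariety.dim_prod]; omega

/-- **The ON-residue class of sixfolds is inhabited, unconditionally** (by a non-simple CM sixfold): the binder class of
the cover's §2 (`hcOnClass_residueClass_six`) is not empty either. [cite: Shimura1998, §6.2 Theorem 3 (pp. 41–42)]
[cite: Milne1999, §2 p. 54] -/
theorem exists_dim_six_residueClass :
    ∃ A : AbelianVariety ℂ,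
      (IsOfCMType A ∨ ProdCMCell IsQuarticFieldTypeIVFourfold (fun Z ↦ Z.dim = 2) A) ∧ A.dim = 6 := by
  obtain ⟨A, h6, hcm, -⟩ := exists_dim_six_cm_not_isSimple
  exact ⟨A, Or.inl hcm, h6⟩

/-- The narrowed CM binder `hCMns` of `hcAtDim_six_of_tableX_cmSplit` is NOT a statement about the empty class.
[cite: Shimura1998, §6.2 Theorem 3 (pp. 41–42)] [cite: Milne1999, §2 p. 54] -/
theorem not_cmNonsimpleSix_vacuous :
    ¬ ∀ A : AbelianVariety ℂ, ¬ (A.dim = 6 ∧ IsOfCMType A ∧ ¬ A.IsSimple) := by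
  obtain ⟨A, h6, hcm, hs⟩ := exists_dim_six_cm_not_isSimple
  exact fun h ↦ h A ⟨h6, hcm, hs⟩

/-- **Both halves of the re-assembly `hcAtDim_six_of_offResidue_of_onResidue` are over non-empty classes**: in
dimension `6` there are abelian varieties off the residue AND on the residue, so neither the per-variety theorem
nor the residue binders can be discharged "by emptiness"; `HCAtDim 6` genuinely needs both.
[cite: MoonenZarhin1999LowDim, §5] [cite: Shimura1998, §6.2 Theorem 3] -/
theorem offResidue_and_onResidue_six_nonempty :
    (∃ A : AbelianVariety ℂ, A.dim = 6 ∧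
        ¬ (IsOfCMType A ∨ ProdCMCell IsQuarticFieldTypeIVFourfold (fun Z ↦ Z.dim = 2) A)) ∧
      (∃ A : AbelianVariety ℂ,
        (IsOfCMType A ∨ ProdCMCell IsQuarticFieldTypeIVFourfold (fun Z ↦ Z.dim = 2) A) ∧ A.dim = 6) :=
  ⟨exists_dim_six_offResidue, exists_dim_six_residueClass⟩

/-! ## §5 (v2) The CM-splitness hypothesis `hS` and both branches of the v3 CM split are over non-empty domains -/

/-- **The domain of the displayed CM-splitness hypothesis `hS` of `hcAtDim_six_of_tableX_cmSplit` is inhabited,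
UNCONDITIONALLY**: there are a SIMPLE complex abelian sixfold `A` of CM type and an endomorphism `φ` with `(A, φ)` of
Weil type `(3, d)` — any realisation of the primitive degenerate CM type `(ℚ(ζ₂₁); Φ₂₁)` (ring 2's
`exists_isSimpleCMSixfold_and_hasBalancedQuadraticEndomorphism_of_cmAbelianVarietyRealised`, whose realisation record
`PicardCM.CMAbelianVarietyRealised` is now the tree theorem `CMAbelianVarietyRealised_holds`; the eigenvalue binder
`eigenMultiplicity A φ (i√d) = 3` is `IsWeilType A φ 3 d` by ring 2's bridge `isWeilType_of_eigenMultiplicity_eq`). So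
`hS : ∀ A φ d, IsSimpleCMSixfold A → IsWeilType A φ 3 d → …` (TABLE X row 15, COR-CM Theorem A) is a genuine
hypothesis, not a `∀` over an empty domain. Nothing about `hS` or `HC_CM` is proved. [cite: Shimura1998, §6.2 Theorem 3; §8.2 Prop. 26]
[cite: Pohlmann1968, Thm. 1 and §3] [cite: vanGeemen1994HodgeAV, 4.9–4.10] -/
theorem exists_isSimpleCMSixfold_isWeilType :
    ∃ (A : AbelianVariety ℂ) (φ : A ⟶ A) (d : ℕ), Ring2.Atlas.IsSimpleCMSixfold A ∧ IsWeilType A φ 3 d := by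
  obtain ⟨A, hA, φ, d, hd, hφ, hm⟩ :=
    Ring2.Atlas.exists_isSimpleCMSixfold_and_hasBalancedQuadraticEndomorphism_of_cmAbelianVarietyRealised
      Literature.NumberTheory.Automorphic.PicardCM.CMAbelianVarietyRealised_holds
  exact ⟨A, φ, d, hA, Ring2.Hypotheses.isWeilType_of_eigenMultiplicity_eq (n := 3) (by norm_num) hd
    (by rw [hA.1]) hφ hm⟩

/-- `hS`'s domain spelled as a non-vacuity statement. [cite: Shimura1998, §6.2 Theorem 3; §8.2 Prop. 26] -/
theorem not_cmSplitDomain_vacuous :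
    ¬ ∀ (A : AbelianVariety ℂ) (φ : A ⟶ A) (d : ℕ), Ring2.Atlas.IsSimpleCMSixfold A → ¬ IsWeilType A φ 3 d := by
  obtain ⟨A, φ, d, hA, hW⟩ := exists_isSimpleCMSixfold_isWeilType
  exact fun h ↦ h A φ d hA hW

/-- **Both branches of the cover v3's split of the CM binder at dimension 6 are inhabited, unconditionally**: the
SIMPLE CM sixfolds (served by Markman's hyperbolic-sixfold statement + `hS` through
`CorCM.CMSixfoldSplit.hodgeSimpleCMSixfold_of_markmanSixfolds_of_cmSplit`) — even by a Weil-type member — and the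
NON-SIMPLE CM sixfolds (the displayed narrowed binder `hCMns`, TABLE X row 29). So the narrowing performed by
`hcOnClass_residueClass_six_of_cmSplit` is a split of a non-empty class into two non-empty parts; neither branch is
discharged by emptiness. [cite: Shimura1998, §6.2 Theorem 3; §8.2 Prop. 26] [cite: Milne1999, §2 p. 54] -/
theorem cmSplit_branches_six_nonempty :
    (∃ A : AbelianVariety ℂ, (A.dim = 6 ∧ IsOfCMType A ∧ A.IsSimple) ∧ ∃ (φ : A ⟶ A) (d : ℕ), IsWeilType A φ 3 d) ∧
      (∃ A : AbelianVariety ℂ, A.dim = 6 ∧ IsOfCMType A ∧ ¬ A.IsSimple) := by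
  obtain ⟨A, φ, d, ⟨h6, hs, hcm⟩, hW⟩ := exists_isSimpleCMSixfold_isWeilType
  exact ⟨⟨A, ⟨h6, hcm, hs⟩, φ, d, hW⟩, exists_dim_six_cm_not_isSimple⟩

end Summit.HodgeConjecture.HodgeConjecture.TableX
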